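import Summits.ValiantsHypothesis.ValiantsHypothesis.Theorems.BarrierLeverChowHitsThinRowPartitionMinorsRLabelsUsed
import Summits.ValiantsHypothesis.ValiantsHypothesis.Theorems.BarrierLeverChowHitsThinRowPartitionMinorsRFullBasis

/-!
# Route BarrierLever — item `ChowHitsThinRowPartitionMinorsR` (stmt-ValiantsHypothesis-21850, budget
# `h·h`): columns whose monomial basis contains every USED singleton, and DOWN-CLOSED column
# families — every thin layout is hit, at every height

Helper file (`--supports stmt-ValiantsHypothesis-21850`; cell valiant-natproofs, rung V4, 𝒟-side;
seat val-np-p5 gen 28).  Closes NO item; definition-free; imports this seat's `…RLabelsUsed` and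
`…RFullBasis`.

* `det_subsetMatrix_ne_zero` — for ANY injective family `U` of finite sets the inclusion (zeta) matrix
  `[U i ⊆ U j]` is nonsingular (unitriangular along `⊆`).
* `chowHitsHH_of_usedSingletonBasis` — `chowHitsHH_of_singletonBasis` with singleton labels required
  only for the coordinates USED by some column: if the (injective) columns `w` admit an injective
  down-closed monomial basis `U` (`det [U i ⊆ w j] ≠ 0`) with `{c} ∈ U` for every `c ∈ ⋃_j w j`, then
  EVERY thin layout `(u, w)` (`u` injective of size `≤ 2`) is hit by `h·h` affine forms.  The rows are
  relabelled by a permutation so that the empty row carries `∅` and `min(#singleton rows, #used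
  coordinates)` singleton rows carry singleton labels; the budget of `chowHitsHH_of_labels_used` is then
  `max(#used coordinates, #singleton rows) + 2·#pair rows ≤ h + 2·C(h,2) = h·h`.
* `chowHitsHH_of_downClosedColumns` — **if the column family is down-closed (`S ⊆ w j ⇒ S = w j'`),
  every thin layout on it is hit, at every height** (the columns are their own monomial basis).  This
  makes every «thin rows × down-closed Δ» census family of the cell (val-np-p5 g27, kit j321275: 297
  layouts, h = 10…28) a theorem at budget `h·h`.

WHAT THIS IS NOT: item 21850 is NOT proved (columns of positive affine defect on their used
coordinates remain); nothing on items 21882 / 19717, on crux stmt-ValiantsHypothesis-14610, or on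
`VP` versus `VNP`.
-/

set_option linter.dupNamespace false

namespace Summit.ValiantsHypothesis.ValiantsHypothesis.Theorems.BarrierLever.ChowThinHH

open Finset MvPolynomial

variable {h r : ℕ}

/-- The inclusion matrix `[U i ⊆ U j]` of an injective family of finite sets is nonsingular. -/
theorem det_subsetMatrix_ne_zero (U : Fin r → Finset (Fin h)) (hUinj : Function.Injective U) :
    (Matrix.of fun i j : Fin r => if U i ⊆ U j then (1 : ℂ) else 0).det ≠ 0 := by
  classical
  set Z : Matrix (Fin r) (Fin r) ℂ := Matrix.of fun i j : Fin r => if U i ⊆ U j then (1 : ℂ) else 0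
    with hZdef
  have hinj : Function.Injective fun v => Matrix.vecMul v Z := by
    intro c₁ c₂ hc
    rw [← sub_eq_zero]
    set c := c₁ - c₂ with hcdef
    have h0 : ∀ j, ∑ i, c i * (if U i ⊆ U j then (1 : ℂ) else 0) = 0 := by
      intro j
      have e' := congr_fun hc j
      simp only [Matrix.vecMul, dotProduct, hZdef, Matrix.of_apply] at e'
      simp only [hcdef, Pi.sub_apply, sub_mul, Finset.sum_sub_distrib]
      exact sub_eq_zero.mpr e'
    -- upward induction on `|U i|`
    have hind : ∀ n : ℕ, ∀ i, (U i).card = n → c i = 0 := by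
      intro n
      induction n using Nat.strong_induction_on with
      | _ n ih =>
        intro i hn
        have hsum := h0 i
        rw [← Finset.add_sum_erase _ _ (Finset.mem_univ i), if_pos (subset_refl _), mul_one] at hsum
        have hrest : ∑ i₂ ∈ (Finset.univ : Finset (Fin r)).erase i,
            c i₂ * (if U i₂ ⊆ U i then (1 : ℂ) else 0) = 0 := by
          refine Finset.sum_eq_zero fun i₂ hi₂ => ?_
          have hne : i₂ ≠ i := (Finset.mem_erase.mp hi₂).1
          by_cases hsub : U i₂ ⊆ U i
          · have hne' : U i₂ ≠ U i := fun e' => hne (hUinj e')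
            have hlt : (U i₂).card < (U i).card := Finset.card_lt_card (lt_of_le_of_ne hsub hne')
            rw [ih (U i₂).card (by omega) i₂ rfl, zero_mul]
          · rw [if_neg hsub, mul_zero]
        rw [hrest, add_zero] at hsum
        exact hsum
    funext i
    exact hind _ i rfl
  have hu' := Matrix.vecMul_injective_iff_isUnit.mp hinj
  exact ((Matrix.isUnit_iff_isUnit_det _).mp hu').ne_zero

/-- **A monomial basis with every USED singleton: every thin layout is hit by `h·h` affine
forms.** -/
theorem chowHitsHH_of_usedSingletonBasis (h r : ℕ) (u w : Fin r → Finset (Fin h))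
    (hu : Function.Injective u) (hu2 : ∀ i, (u i).card ≤ 2)
    (U : Fin r → Finset (Fin h)) (hUinj : Function.Injective U)
    (hUdown : ∀ i (S : Finset (Fin h)), S ⊆ U i → ∃ i', U i' = S)
    (hZ : (Matrix.of fun i j : Fin r => if U i ⊆ w j then (1 : ℂ) else 0).det ≠ 0)
    (hUsing : ∀ c ∈ Finset.univ.biUnion w, ∃ i, U i = {c}) :
    ∃ ℓ : Fin (h * h) → MvPolynomial (Fin (h + h)) ℂ, (∀ k, (ℓ k).totalDegree ≤ 1) ∧
      (Matrix.of fun i j : Fin r => MvPolynomial.coeff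
        (∑ a ∈ u i, Finsupp.single (Fin.castAdd h a) 1 +
          ∑ c ∈ w j, Finsupp.single (Fin.natAdd h c) 1) (∏ k, ℓ k)).det ≠ 0 := by
  classical
  -- special rows and special labels
  set Sing : Finset (Fin r) := Finset.univ.filter fun i : Fin r => (u i).card = 1 with hSing
  set SLab : Finset (Fin r) := Finset.univ.filter fun j : Fin r => (U j).card = 1 with hSLab
  set Cu : Finset (Fin h) := Finset.univ.biUnion w with hCu
  -- a singleton label is a used singleton (else its row of `[U i ⊆ w j]` vanishes)
  have hlab_used : ∀ i c, U i = {c} → c ∈ Cu := by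
    intro i c hic
    by_contra hc
    apply hZ
    refine Matrix.det_eq_zero_of_row_eq_zero i fun j => ?_
    rw [Matrix.of_apply, if_neg]
    intro hsub
    apply hc
    rw [hCu, Finset.mem_biUnion]
    exact ⟨j, Finset.mem_univ _, hsub (by rw [hic]; exact Finset.mem_singleton_self c)⟩
  -- used singletons are exactly the singleton labels
  have hSLabCu : SLab.image U = Cu.image fun c : Fin h => ({c} : Finset (Fin h)) := by
    ext S
    simp only [Finset.mem_image, hSLab, Finset.mem_filter, Finset.mem_univ, true_and]
    constructor
    · rintro ⟨j, hj, rfl⟩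
      obtain ⟨c, hc⟩ := Finset.card_eq_one.mp hj
      exact ⟨c, hlab_used j c hc, hc.symm⟩
    · rintro ⟨c, hc, rfl⟩
      obtain ⟨j', hj'⟩ := hUsing c hc
      exact ⟨j', by rw [hj']; exact Finset.card_singleton c, hj'⟩
  -- the empty label
  have hemptyLab : ∀ i, u i = ∅ → ∃ j, U j = ∅ := fun i _ =>
    hUdown i ∅ (Finset.empty_subset _)
  -- an injection between Sing and SLab in the right direction
  obtain ⟨M, hMsub, hMcard, g, hg⟩ : ∃ M : Finset (Fin r), M ⊆ Sing ∧
      M.card = min Sing.card SLab.card ∧ ∃ g : Fin r → Fin r, Set.InjOn g M ∧ ∀ i ∈ M, g i ∈ SLab := by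
    obtain ⟨M, hMsub, hMcard⟩ := Finset.exists_subset_card_eq
      (show min Sing.card SLab.card ≤ Sing.card from min_le_left _ _)
    have hle : M.card ≤ SLab.card := by rw [hMcard]; exact min_le_right _ _
    have hc : Fintype.card M ≤ Fintype.card SLab := by simpa using hle
    obtain ⟨ι⟩ := Function.Embedding.nonempty_of_card_le hc
    refine ⟨M, hMsub, hMcard, fun i => if hi : i ∈ M then (ι ⟨i, hi⟩ : Fin r) else i, ?_, ?_⟩
    · intro i hi i' hi' e
      simp only [dif_pos (show i ∈ M from hi), dif_pos (show i' ∈ M from hi')] at e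
      have := ι.injective (Subtype.ext e)
      exact congrArg Subtype.val this
    · intro i hi
      simp only [dif_pos hi]
      exact (ι ⟨i, hi⟩).2
  -- the empty-label index (used only when some row is empty)
  set j0 : Fin r → Fin r := fun i => if hx : ∃ j, U j = ∅ then Classical.choose hx else i with hj0
  have hj0 : ∀ i, u i = ∅ → U (j0 i) = ∅ := by
    intro i hi
    have hx : ∃ j, U j = ∅ := hemptyLab i hi
    simp only [hj0, dif_pos hx]
    exact Classical.choose_spec hx
  set Zr : Finset (Fin r) := Finset.univ.filter fun i : Fin r => u i = ∅ with hZr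
  set C : Finset (Fin r) := Zr ∪ M with hC
  set f : Fin r → Fin r := fun i => if u i = ∅ then j0 i else g i with hf
  have hfZ : ∀ i, u i = ∅ → U (f i) = ∅ := fun i hi => by simp only [hf, if_pos hi]; exact hj0 i hi
  have hfM : ∀ i ∈ M, f i = g i := by
    intro i hi
    have h1 : (u i).card = 1 := (Finset.mem_filter.mp (hMsub hi)).2
    have hne : u i ≠ ∅ := fun e => by rw [e, Finset.card_empty] at h1; exact zero_ne_one h1
    simp only [hf, if_neg hne]
  have hinj : Set.InjOn f C := by
    intro i hi i' hi' e
    rcases Finset.mem_union.mp hi with hiZ | hiM <;> rcases Finset.mem_union.mp hi' with hi'Z | hi'M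
    · exact hu ((Finset.mem_filter.mp hiZ).2.trans (Finset.mem_filter.mp hi'Z).2.symm)
    · exfalso
      have h0 : U (f i) = ∅ := hfZ i (Finset.mem_filter.mp hiZ).2
      have h1 : (U (f i')).card = 1 := by
        rw [hfM i' hi'M]; exact (Finset.mem_filter.mp (hg.2 i' hi'M)).2
      rw [← e, h0, Finset.card_empty] at h1
      exact zero_ne_one h1
    · exfalso
      have h0 : U (f i') = ∅ := hfZ i' (Finset.mem_filter.mp hi'Z).2
      have h1 : (U (f i)).card = 1 := by
        rw [hfM i hiM]; exact (Finset.mem_filter.mp (hg.2 i hiM)).2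
      rw [e, h0, Finset.card_empty] at h1
      exact zero_ne_one h1
    · rw [hfM i hiM, hfM i' hi'M] at e
      exact hg.1 hiM hi'M e
  obtain ⟨g', hg'⟩ := Finset.exists_equiv_extend_of_card_eq (t := (Finset.univ : Finset (Fin r)))
    (by simp) (s := C) (f := f) (Finset.subset_univ _) hinj
  set π : Fin r ≃ Fin r := g'.trans (Equiv.subtypeUnivEquiv Finset.mem_univ) with hπ
  have hπC : ∀ i ∈ C, π i = f i := by
    intro i hi
    rw [← hg' i hi]
    rfl
  -- Step 2: the relabelling `U' = U ∘ π`
  set U' : Fin r → Finset (Fin h) := fun i => U (π i) with hU'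
  have hU'inj : Function.Injective U' := hUinj.comp π.injective
  have hU'down : ∀ i (S : Finset (Fin h)), S ⊆ U' i → ∃ i', U' i' = S := by
    intro i S hS
    obtain ⟨j', hj'⟩ := hUdown (π i) S hS
    exact ⟨π.symm j', by simp only [hU', Equiv.apply_symm_apply, hj']⟩
  have hU'empty : ∀ i, u i = ∅ → U' i = ∅ := by
    intro i hi
    have hiC : i ∈ C := Finset.mem_union_left _ (Finset.mem_filter.mpr ⟨Finset.mem_univ _, hi⟩)
    show U (π i) = ∅
    rw [hπC i hiC]
    exact hfZ i hi
  have hU'M : ∀ i ∈ M, U' i ∈ Cu.image fun c : Fin h => ({c} : Finset (Fin h)) := by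
    intro i hi
    have hiC : i ∈ C := Finset.mem_union_right _ hi
    rw [← hSLabCu]
    refine Finset.mem_image.mpr ⟨π i, ?_, rfl⟩
    rw [hπC i hiC, hfM i hi]
    exact hg.2 i hi
  have hZ' : (Matrix.of fun i j : Fin r => if U' i ⊆ w j then (1 : ℂ) else 0).det ≠ 0 := by
    have e : (Matrix.of fun i j : Fin r => if U' i ⊆ w j then (1 : ℂ) else 0) =
        (Matrix.of fun i j : Fin r => if U i ⊆ w j then (1 : ℂ) else 0).submatrix π id := by
      ext i j
      rfl
    rw [e, Matrix.det_permute]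
    refine mul_ne_zero ?_ hZ
    rcases Int.units_eq_one_or (Equiv.Perm.sign π) with h1 | h1 <;> simp [h1]
  -- Step 3: the budget `max(#used singletons, #singleton rows) + 2·#pairs ≤ h·h`
  refine chowHitsHH_of_labels_used h r u w hu hu2 U' hU'inj hU'down hU'empty hZ' ?_
  have hsub : Sing.image U' ∪ Cu.image (fun c : Fin h => ({c} : Finset (Fin h))) ⊆
      (Sing \ M).image U' ∪ Cu.image (fun c : Fin h => ({c} : Finset (Fin h))) := by
    intro S hS
    rcases Finset.mem_union.mp hS with h1 | h2
    · obtain ⟨i, hi, rfl⟩ := Finset.mem_image.mp h1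
      by_cases hiM : i ∈ M
      · exact Finset.mem_union_right _ (hU'M i hiM)
      · exact Finset.mem_union_left _ (Finset.mem_image.mpr ⟨i, Finset.mem_sdiff.mpr ⟨hi, hiM⟩, rfl⟩)
    · exact Finset.mem_union_right _ h2
  have hSing_le : Sing.card ≤ h := by
    rw [← Finset.card_image_of_injective _ hu]
    refine (Finset.card_le_card ?_).trans
      (Finset.card_image_le.trans (by rw [Finset.card_univ, Fintype.card_fin]) :
        (Finset.univ.image fun c : Fin h => ({c} : Finset (Fin h))).card ≤ h)
    intro S hS
    obtain ⟨i, hi, rfl⟩ := Finset.mem_image.mp hS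
    obtain ⟨c, hc⟩ := Finset.card_eq_one.mp (Finset.mem_filter.mp hi).2
    exact Finset.mem_image.mpr ⟨c, Finset.mem_univ _, hc.symm⟩
  have hSLab_le : SLab.card ≤ h := by
    rw [← Finset.card_image_of_injective _ hUinj, hSLabCu]
    exact Finset.card_image_le.trans ((Finset.card_le_univ _).trans (by rw [Fintype.card_fin]))
  have hCu_card : (Cu.image fun c : Fin h => ({c} : Finset (Fin h))).card = SLab.card := by
    rw [← hSLabCu, Finset.card_image_of_injective _ hUinj]
  have hbound : (Sing.image U' ∪ Cu.image (fun c : Fin h => ({c} : Finset (Fin h)))).card ≤ h := by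
    refine (Finset.card_le_card hsub).trans ((Finset.card_union_le _ _).trans ?_)
    rw [hCu_card]
    refine (Nat.add_le_add_right Finset.card_image_le _).trans ?_
    rw [Finset.card_sdiff_of_subset hMsub, hMcard]
    rcases le_total Sing.card SLab.card with hle | hle
    · rw [min_eq_left hle]; omega
    · rw [min_eq_right hle]; omega
  have h2 := card_pairRows_le u hu
  have h3 := add_two_mul_choose_two h
  show (Sing.image U' ∪ Cu.image (fun c : Fin h => ({c} : Finset (Fin h)))).card +
      2 * (Finset.univ.filter fun i : Fin r => (u i).card = 2).card ≤ h * h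
  nlinarith

/-- **Down-closed column families: every thin layout is hit by `h·h` affine forms**, at every
height (the columns are their own monomial basis; `det_subsetMatrix_ne_zero`). -/
theorem chowHitsHH_of_downClosedColumns (h r : ℕ) (u w : Fin r → Finset (Fin h))
    (hu : Function.Injective u) (hu2 : ∀ i, (u i).card ≤ 2) (hw : Function.Injective w)
    (hwdown : ∀ j (S : Finset (Fin h)), S ⊆ w j → ∃ j', w j' = S) :
    ∃ ℓ : Fin (h * h) → MvPolynomial (Fin (h + h)) ℂ, (∀ k, (ℓ k).totalDegree ≤ 1) ∧
      (Matrix.of fun i j : Fin r => MvPolynomial.coeff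
        (∑ a ∈ u i, Finsupp.single (Fin.castAdd h a) 1 +
          ∑ c ∈ w j, Finsupp.single (Fin.natAdd h c) 1) (∏ k, ℓ k)).det ≠ 0 := by
  classical
  refine chowHitsHH_of_usedSingletonBasis h r u w hu hu2 w hw hwdown (det_subsetMatrix_ne_zero w hw) ?_
  intro c hc
  obtain ⟨j, -, hcj⟩ := Finset.mem_biUnion.mp hc
  exact hwdown j {c} (Finset.singleton_subset_iff.mpr hcj)

end Summit.ValiantsHypothesis.ValiantsHypothesis.Theorems.BarrierLever.ChowThinHH
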